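import Mathlib.Analysis.Calculus.FDeriv.Mul
import Mathlib.Analysis.Calculus.FDeriv.Pow
import Literature.NumberTheory.Transcendental.AnalytificationChartsProofs
import HarnessLib

/-!
# A rational cotangent frame at a rational point of an analytification (GAGA at one point)

Family `hodge`, layer `Literature/NumberTheory/Transcendental`, next to `Analytification.lean`
(the predicate `IsAnalytification E Y d φ`: `φ : M → Y(ℂ)` exhibits the complex charted space `M`
as `Y^an` for a `k`-scheme `Y`, `k ⊆ ℂ`) and `AnalytificationCotangentChart.lean` (free algebraic
coordinates have dual tangent vectors).  Theorems only; no definition, no named fact (D-0026).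

Let `Y` be a `k`-scheme, smooth of relative dimension `d` and locally of finite type, `φ : M → Y(ℂ)`
an analytification with a holomorphic atlas on `M`, and `P ∈ M` a point lying over a
**`k`-rational point**: every regular function `s ∈ Γ(Y, U)` (`U ∋ pt(φ P)`) takes at `φ P` a value
in `k ⊆ ℂ`.  Read a regular function `s` near `P` in the preferred chart `χ = chartAt E P` of `M`:
`z ↦ s(φ(χ⁻¹ z))`, a holomorphic function near `χ P` (`IsAnalytification`), with differential
`d_P s ∈ E^* = Hom_ℂ(E, ℂ)` at `χ P` — the "algebraic differentials at `P`".

* `IsAnalytification.exists_rational_cotangentFrame` — **the `k`-span of the algebraic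
  differentials at a `k`-rational point is a `k`-form of the cotangent space.**  There are
  `ℓ₁, …, ℓ_d ∈ E^*`, linearly independent over `ℂ` and spanning `E^*`, each of which is the
  differential at `P` of a regular function defined over `k`, such that the differential at `P` of
  EVERY regular function over `k` on every open `U ∋ pt(φ P)` is a `k`-LINEAR combination
  `∑ᵢ cᵢ ℓᵢ`, `cᵢ ∈ k`.

This is the local content, at a simple `k`-rational point, of Serre's «au voisinage d'un point
simple les coordonnées locales sont des fonctions régulières» (GAGA §2 n°6 Prop. 3 Cor. 2 with §1
n°4) joined with the `k`-structure of the Zariski cotangent space `𝔪_y/𝔪_y²` of a `k`-rational point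
and its base change `T_y(Y) ⊗_k ℂ = T_y(Y_ℂ)` (Görtz–Wedhorn I, (6.6.2)–(6.6.3), Prop. 6.6 / Thm.
6.28: at a smooth `k`-rational point the local parameters may be chosen among the `k`-regular
functions and `dim_k 𝔪_y/𝔪_y² = d`); it is what Shimura, *Abelian Varieties with Complex
Multiplication* §2.6 Prop. 3 («`𝔇₀(G; k)` is of dimension `n` over `k` and
`𝔇₀(G) = 𝔇₀(G; k) ⊗_k Ω`») uses at the origin of a group variety.  On the tree's EXTRINSIC
analytification predicate (which records only that regular functions are holomorphic on the given
manifold `M`) the statement is not a tautology; the proof: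

1. (*standard smooth coordinates*) `pt(φ P)` has an affine neighbourhood `V` with
   `Γ(Y, V) = k[xᵢ : i ∈ ι]/(f_j : j ∈ σ)` a submersive presentation of dimension `d`
   (`AlgPoints.exists_isStandardSmoothOfRelativeDimension_scalarRingHom`): distinguished variables
   `x_{c(j)}`, Jacobian minor `det (∂f_j/∂x_{c(j')})` a unit;
2. (*the frame*) the `d` FREE coordinates `x_a ∘ φ`, read in `χ`, are injective near `χ P`
   (uniqueness half of the implicit function theorem for the relations,
   `exists_isOpen_injOn_of_det_ne_zero`, and `V(ℂ) ↪ ℂ^ι`), so by Clements–Osgood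
   (`Literature.Analysis.Complex.SCV.bijective_fderiv_of_injOn`) their joint differential
   `E → ℂ^{free}` is bijective: the `ℓ_a := d_P x_a` form a basis of `E^*` — exactly as in
   `IsAnalytification.exists_dual_fderiv_coord`;
3. (*distinguished coordinates*) differentiating the relations `f_j(x ∘ φ) = 0` at `P` and
   inverting the Jacobian minor OVER `k` (the point is `k`-rational, so all values `xᵢ(φ P)` and all
   partial derivatives of the `f_j` there lie in `k`), every `d_P x_{c(j)}` is a `k`-combination of
   the `ℓ_a`;
4. (*sections of `V`*) every `g ∈ Γ(Y, V)` is a polynomial over `k` in the `xᵢ` as a function on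
   `V(ℂ)` (`AlgPoints.eval_eq_eval_map_σ`), so `d_P g = ∑ᵢ (∂p/∂xᵢ)(x(φP)) d_P xᵢ` (chain rule,
   `MvPolynomial.hasStrictFDerivAt_eval`) with coefficients in `k`;
5. (*arbitrary opens*) a section `s` over `U ∋ pt(φ P)` is, on a basic open `D(f) ⊆ U ∩ V` around
   the point, a fraction: `s · fⁿ = g` with `f, g ∈ Γ(Y, V)`, `f(φP) ≠ 0`
   (`AlgPoints.exists_fraction`); the product rule at `P` and `f(φ P), s(φ P) ∈ k` finish.

## References

* J.-P. Serre, *Géométrie algébrique et géométrie analytique*, Ann. Inst. Fourier 6 (1956), §1 n°4,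
  §2 n°5 Prop. 2, n°6 Prop. 3 Cor. 2. [SerreGAGA1956]
* U. Görtz, T. Wedhorn, *Algebraic Geometry I*, 2nd ed. (2020), §6.6 (6.6.2)–(6.6.3), Thm. 6.28.
  [GortzWedhorn2020]
* G. Shimura, *Abelian Varieties with Complex Multiplication and Modular Functions* (1998), §2.6
  Prop. 3 (p. 20). [Shimura1998]
* K. Fritzsche, H. Grauert, *From Holomorphic Functions to Complex Manifolds* (2002), Ch. I §8
  Thm. 8.5. [FritzscheGrauert2002]
-/

noncomputable section

universe u

open CategoryTheory AlgebraicGeometry Topology Filter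
open scoped Manifold ContDiff

namespace Literature.NumberTheory.Transcendental

/-! ### Linear algebra: `k`-combinations inside a `ℂ`-vector space -/

section KSpan

variable {k : Type*} [Field k] [Algebra k ℂ] {W : Type*} [AddCommGroup W] [Module ℂ W]
  {I : Type*} [Fintype I] (ℓ : I → W)

/-- `k`-combinations of a family are closed under addition. [folklore] -/
private theorem exists_eq_sum_algebraMap_smul_add {u v : W} (hu : ∃ c : I → k, u = ∑ i, algebraMap k ℂ (c i) • ℓ i)
    (hv : ∃ c : I → k, v = ∑ i, algebraMap k ℂ (c i) • ℓ i) :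
    ∃ c : I → k, u + v = ∑ i, algebraMap k ℂ (c i) • ℓ i := by
  obtain ⟨a, rfl⟩ := hu
  obtain ⟨b, rfl⟩ := hv
  refine ⟨a + b, ?_⟩
  rw [← Finset.sum_add_distrib]
  exact Finset.sum_congr rfl fun i _ ↦ by rw [Pi.add_apply, map_add, add_smul]

/-- `k`-combinations of a family are closed under scalars from `k`. [folklore] -/
private theorem exists_eq_sum_algebraMap_smul_smul {u : W} (hu : ∃ c : I → k, u = ∑ i, algebraMap k ℂ (c i) • ℓ i)
    (a : k) : ∃ c : I → k, algebraMap k ℂ a • u = ∑ i, algebraMap k ℂ (c i) • ℓ i := by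
  obtain ⟨b, rfl⟩ := hu
  refine ⟨fun i ↦ a * b i, ?_⟩
  rw [Finset.smul_sum]
  exact Finset.sum_congr rfl fun i _ ↦ by rw [map_mul, mul_smul]

/-- `0` is a `k`-combination. [folklore] -/
private theorem exists_eq_sum_algebraMap_smul_zero :
    ∃ c : I → k, (0 : W) = ∑ i, algebraMap k ℂ (c i) • ℓ i :=
  ⟨0, by simp⟩

/-- A finite sum `∑_l a_l • u_l` with `a_l ∈ k` of `k`-combinations is a `k`-combination. [folklore] -/
private theorem exists_eq_sum_algebraMap_smul_sum {L : Type*} (s : Finset L) (a : L → k) (u : L → W)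
    (hu : ∀ l ∈ s, ∃ c : I → k, u l = ∑ i, algebraMap k ℂ (c i) • ℓ i) :
    ∃ c : I → k, ∑ l ∈ s, algebraMap k ℂ (a l) • u l = ∑ i, algebraMap k ℂ (c i) • ℓ i := by
  classical
  induction s using Finset.induction_on with
  | empty => simpa using exists_eq_sum_algebraMap_smul_zero ℓ
  | insert l s hl ih =>
    rw [Finset.sum_insert hl]
    exact exists_eq_sum_algebraMap_smul_add ℓ
      (exists_eq_sum_algebraMap_smul_smul ℓ (hu l (Finset.mem_insert_self l s)) (a l))
      (ih fun l' hl' ↦ hu l' (Finset.mem_insert_of_mem hl'))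

/-- The members of the family are `k`-combinations. [folklore] -/
private theorem exists_eq_sum_algebraMap_smul_self [DecidableEq I] (i : I) :
    ∃ c : I → k, ℓ i = ∑ j, algebraMap k ℂ (c j) • ℓ j :=
  ⟨Pi.single i 1, by
    rw [Finset.sum_eq_single i (fun j _ hj ↦ by rw [Pi.single_eq_of_ne hj, map_zero, zero_smul])
      (fun h ↦ absurd (Finset.mem_univ i) h), Pi.single_eq_same, map_one, one_smul]⟩

/-- **Cramer over `k`**: if `∑_{j'} J_{j j'} • u_{j'} = r_j` for an invertible matrix `J` over `k`,
then `u_{j''} = ∑_j (J⁻¹)_{j'' j} • r_j`; in particular the `u`'s are `k`-combinations of a family as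
soon as the `r`'s are. [folklore] -/
private theorem exists_eq_sum_algebraMap_smul_of_matrix {σ : Type*} [Fintype σ] [DecidableEq σ]
    (J : Matrix σ σ k) (hJ : J.det ≠ 0) (u r : σ → W)
    (h : ∀ j, ∑ j', algebraMap k ℂ (J j j') • u j' = r j)
    (hr : ∀ j, ∃ c : I → k, r j = ∑ i, algebraMap k ℂ (c i) • ℓ i) (j'' : σ) :
    ∃ c : I → k, u j'' = ∑ i, algebraMap k ℂ (c i) • ℓ i := by
  have hunit : IsUnit J.det := isUnit_iff_ne_zero.2 hJ
  have key : u j'' = ∑ j, algebraMap k ℂ (J⁻¹ j'' j) • r j := by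
    simp_rw [← h, Finset.smul_sum, smul_smul, ← map_mul]
    rw [Finset.sum_comm]
    simp_rw [← Finset.sum_smul, ← map_sum, ← Matrix.mul_apply, Matrix.nonsing_inv_mul J hunit]
    rw [Finset.sum_eq_single j'' (fun j _ hj ↦ by
        rw [Matrix.one_apply_ne' hj, map_zero, zero_smul])
      (fun hj ↦ absurd (Finset.mem_univ j'') hj), Matrix.one_apply_eq, map_one, one_smul]
  rw [key]
  exact exists_eq_sum_algebraMap_smul_sum ℓ Finset.univ (fun j ↦ J⁻¹ j'' j) r fun j _ ↦ hr j

end KSpan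

/-! ### The chain rule for a polynomial in differentiable functions -/

section PolyChain

variable {E : Type*} [NormedAddCommGroup E] [NormedSpace ℂ E] {ι : Type*} [Fintype ι]

/-- **Chain rule for `z ↦ p(x₁(z), …, xₙ(z))`**: if `x_l` has differential `D_l` at `z₀` then
`p ∘ x` has differential `∑_l (∂p/∂x_l)(x(z₀)) • D_l` at `z₀`. [folklore] -/
private theorem hasFDerivAt_mvPolynomial_eval_comp (p : MvPolynomial ι ℂ) {x : ι → E → ℂ}
    {D : ι → E →L[ℂ] ℂ} {z₀ : E} (hx : ∀ l, HasFDerivAt (x l) (D l) z₀) :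
    HasFDerivAt (fun z ↦ MvPolynomial.eval (fun l ↦ x l z) p)
      (∑ l, MvPolynomial.eval (fun l ↦ x l z₀) (MvPolynomial.pderiv l p) • D l) z₀ := by
  have hpi : HasFDerivAt (fun z l ↦ x l z) (ContinuousLinearMap.pi D) z₀ :=
    hasFDerivAt_pi.2 hx
  have h := ((MvPolynomial.hasStrictFDerivAt_eval p (fun l ↦ x l z₀)).hasFDerivAt).comp z₀ hpi
  refine h.congr_fderiv ?_
  ext w
  simp only [ContinuousLinearMap.coe_comp, Function.comp_apply, FunLike.coe_sum,
    Finset.sum_apply, FunLike.coe_smul, Pi.smul_apply, ContinuousLinearMap.proj_apply,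
    ContinuousLinearMap.pi_apply, smul_eq_mul]

end PolyChain


/-! ### Regular functions read in a chart of an analytification -/

namespace IsAnalytification

open Literature.AlgebraicGeometry.Motives (AlgPoints ComplexPoints SchemeOver)
open Literature.AlgebraicGeometry.Motives.AlgPoints

variable {E : Type*} [NormedAddCommGroup E] [NormedSpace ℂ E] [FiniteDimensional ℂ E]
  {M : Type*} [TopologicalSpace M] [ChartedSpace E M]
  {k : Type} [Field k] [Algebra k ℂ] {Y : SchemeOver k} {d : ℕ} {φ : M → ComplexPoints Y}

/-- A regular function `s ∈ Γ(Y, U)` read in the preferred chart `χ` of `M` at `P`,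
`z ↦ s(φ(χ⁻¹ z))`, is complex-differentiable at every `z ∈ χ.target` over `U(ℂ)` (regular
functions are holomorphic on an analytification, `mdifferentiableOn_evalOrZero_opens_holds`).
[cite: SerreGAGA1956, §2 n°5 Prop. 2] -/
theorem differentiableAt_evalOrZero_chart [IsManifold 𝓘(ℂ, E) ω M] (hφ : IsAnalytification E Y d φ)
    (P : M) (U : Y.left.Opens) (s : Γ(Y.left, U)) {z : E} (hz : z ∈ (chartAt E P).target)
    (hzU : (φ ((chartAt E P).symm z)).pt ∈ U) :
    DifferentiableAt ℂ (fun z ↦ evalOrZero U s (φ ((chartAt E P).symm z))) z := by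
  haveI : IsManifold 𝓘(ℂ, E) 1 M := inferInstance
  have h1 : MDifferentiableAt 𝓘(ℂ, E) 𝓘(ℂ, ℂ) (fun m ↦ evalOrZero U s (φ m))
      ((chartAt E P).symm z) :=
    (mdifferentiableOn_evalOrZero_opens_holds hφ U s).mdifferentiableAt
      ((hφ.isOpen_preimage U).mem_nhds hzU)
  have h2 : MDifferentiableAt 𝓘(ℂ, E) 𝓘(ℂ, E) (chartAt E P).symm z :=
    mdifferentiableAt_atlas_symm (chart_mem_atlas E P) hz
  exact mdifferentiableAt_iff_differentiableAt.1 (h1.comp z h2)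

/-- The set of chart parameters `z ∈ χ.target` with `φ(χ⁻¹ z) ∈ U(ℂ)` is an open neighbourhood of
`χ P` when `pt(φ P) ∈ U`. [folklore] -/
private theorem chart_preimage_mem_nhds (hφ : IsAnalytification E Y d φ) (P : M) (U : Y.left.Opens)
    (hPU : (φ P).pt ∈ U) :
    (chartAt E P).target ∩ (chartAt E P).symm ⁻¹' (φ ⁻¹' {R | R.pt ∈ U}) ∈ 𝓝 (chartAt E P P) := by
  refine ((chartAt E P).isOpen_inter_preimage_symm (hφ.isOpen_preimage U)).mem_nhds ⟨?_, ?_⟩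
  · exact (chartAt E P).map_source (mem_chart_source E P)
  · show φ ((chartAt E P).symm (chartAt E P P)) ∈ {R | R.pt ∈ U}
    rw [(chartAt E P).left_inv (mem_chart_source E P)]
    exact hPU

/-- A regular function on `U ∋ pt(φ P)` read in the chart at `P` has a differential at `χ P`.
[cite: SerreGAGA1956, §2 n°5 Prop. 2] -/
theorem hasFDerivAt_evalOrZero_chart [IsManifold 𝓘(ℂ, E) ω M] (hφ : IsAnalytification E Y d φ)
    (P : M) (U : Y.left.Opens) (s : Γ(Y.left, U)) (hPU : (φ P).pt ∈ U) :
    HasFDerivAt (fun z ↦ evalOrZero U s (φ ((chartAt E P).symm z)))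
      (fderiv ℂ (fun z ↦ evalOrZero U s (φ ((chartAt E P).symm z))) (chartAt E P P))
      (chartAt E P P) := by
  refine (differentiableAt_evalOrZero_chart hφ P U s
    ((chartAt E P).map_source (mem_chart_source E P)) ?_).hasFDerivAt
  rw [(chartAt E P).left_inv (mem_chart_source E P)]
  exact hPU

/-! ### From the sections of one affine open to all regular functions: local fractions -/

/-- **Local fractions step.**  Let `V ∋ pt(φ P)` be an affine open such that the differential at
`P` of every `g ∈ Γ(Y, V)` (read in the chart at `P`) is a `k`-combination of a fixed family `ℓ`,
and assume `φ P` is `k`-rational (values of regular functions at `φ P` lie in `k`).  Then the same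
holds for every regular function `s` on every open `U ∋ pt(φ P)`: on a basic open
`D(f) ⊆ U ∩ V` around the point, `s · fⁿ = g` with `f, g ∈ Γ(Y, V)` (`AlgPoints.exists_fraction`),
and the product rule at `P` with `f(φP) ∈ kˣ`, `s(φP) ∈ k` expresses `d_P s` through `d_P f`,
`d_P g`. [cite: SerreGAGA1956, §2 n°5 Lemme 1 c)] -/
theorem exists_hasFDerivAt_eq_sum_of_affine [IsManifold 𝓘(ℂ, E) ω M]
    (hφ : IsAnalytification E Y d φ) {P : M} {V : Y.left.Opens} (hV : IsAffineOpen V)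
    (hPV : (φ P).pt ∈ V)
    (hP : ∀ (U : Y.left.Opens) (hU : (φ P).pt ∈ U) (s : Γ(Y.left, U)),
      ∃ c : k, (φ P).eval U hU s = algebraMap k ℂ c)
    {I : Type*} [Fintype I] (ℓ : I → E →L[ℂ] ℂ)
    (hVrat : ∀ g : Γ(Y.left, V), ∃ c : I → k,
      HasFDerivAt (fun z ↦ evalOrZero V g (φ ((chartAt E P).symm z)))
        (∑ i, algebraMap k ℂ (c i) • ℓ i) (chartAt E P P))
    (U : Y.left.Opens) (s : Γ(Y.left, U)) (hPU : (φ P).pt ∈ U) :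
    ∃ c : I → k, HasFDerivAt (fun z ↦ evalOrZero U s (φ ((chartAt E P).symm z)))
      (∑ i, algebraMap k ℂ (c i) • ℓ i) (chartAt E P P) := by
  set χ := chartAt E P with hχ
  set Q := φ P with hQ
  obtain ⟨f, g, n, hle, hQf, hfrac⟩ :=
    exists_fraction (L := ℂ) hV s hPV hPU
  -- the three functions read in the chart
  set S : E → ℂ := fun z ↦ evalOrZero U s (φ (χ.symm z)) with hS
  set Ff : E → ℂ := fun z ↦ evalOrZero V f (φ (χ.symm z)) with hFf
  set G : E → ℂ := fun z ↦ evalOrZero V g (φ (χ.symm z)) with hG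
  have hSd : HasFDerivAt S (fderiv ℂ S (χ P)) (χ P) := hasFDerivAt_evalOrZero_chart hφ P U s hPU
  obtain ⟨cf, hcf⟩ := hVrat f
  obtain ⟨cg, hcg⟩ := hVrat g
  -- `S · Ffⁿ = G` near `χ P`
  have hEq : (fun z ↦ S z * Ff z ^ n) =ᶠ[𝓝 (χ P)] G := by
    filter_upwards [chart_preimage_mem_nhds hφ P (Y.left.basicOpen f) hQf] with z hz
    have hzf : (φ (χ.symm z)).pt ∈ Y.left.basicOpen f := hz.2
    have h := hfrac (φ (χ.symm z)) hzf
    simp only [hS, hFf, hG]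
    rw [evalOrZero_of_mem s (hle hzf), evalOrZero_of_mem f (Y.left.basicOpen_le f hzf),
      evalOrZero_of_mem g (Y.left.basicOpen_le f hzf)]
    exact h
  have hprod : HasFDerivAt (fun z ↦ S z * Ff z ^ n)
      (S (χ P) • ((n • Ff (χ P) ^ (n - 1)) • ∑ i, algebraMap k ℂ (cf i) • ℓ i) +
        Ff (χ P) ^ n • fderiv ℂ S (χ P)) (χ P) :=
    hSd.mul (hcf.pow n)
  have huniq : S (χ P) • ((n • Ff (χ P) ^ (n - 1)) • ∑ i, algebraMap k ℂ (cf i) • ℓ i) +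
      Ff (χ P) ^ n • fderiv ℂ S (χ P) = ∑ i, algebraMap k ℂ (cg i) • ℓ i :=
    (hprod.congr_of_eventuallyEq hEq.symm).unique hcg
  -- values at the `k`-rational point
  have hχP : φ (χ.symm (χ P)) = Q := by
    rw [hχ, (chartAt E P).left_inv (mem_chart_source E P)]
  obtain ⟨f₀, hf₀⟩ := hP V hPV f
  obtain ⟨s₀, hs₀⟩ := hP U hPU s
  have hFfP : Ff (χ P) = algebraMap k ℂ f₀ := by
    simp only [hFf]; rw [hχP, evalOrZero_of_mem f hPV, hf₀]
  have hSP : S (χ P) = algebraMap k ℂ s₀ := by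
    simp only [hS]; rw [hχP, evalOrZero_of_mem s hPU, hs₀]
  have hf₀ne : f₀ ≠ 0 := by
    intro h0
    have hne := (pt_mem_basicOpen_iff Q hPV f).1 hQf
    rw [hf₀, h0, map_zero] at hne
    exact hne rfl
  -- solve for `d_P S`
  refine ⟨fun i ↦ (f₀ ^ n)⁻¹ * (cg i - s₀ * (n * f₀ ^ (n - 1)) * cf i), ?_⟩
  have hsolve : fderiv ℂ S (χ P) =
      ∑ i, algebraMap k ℂ ((f₀ ^ n)⁻¹ * (cg i - s₀ * (n * f₀ ^ (n - 1)) * cf i)) • ℓ i := by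
    have hfn : (algebraMap k ℂ f₀) ^ n ≠ 0 := pow_ne_zero _ (by
      rwa [Ne, map_eq_zero_iff _ (algebraMap k ℂ).injective])
    rw [hFfP, hSP] at huniq
    have h2 : (algebraMap k ℂ f₀) ^ n • fderiv ℂ S (χ P) =
        ∑ i, algebraMap k ℂ (cg i) • ℓ i -
          algebraMap k ℂ s₀ • ((n • algebraMap k ℂ f₀ ^ (n - 1)) •
            ∑ i, algebraMap k ℂ (cf i) • ℓ i) := by
      rw [← huniq]; abel
    have h3 : fderiv ℂ S (χ P) = ((algebraMap k ℂ f₀) ^ n)⁻¹ •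
        (∑ i, algebraMap k ℂ (cg i) • ℓ i -
          algebraMap k ℂ s₀ • ((n • algebraMap k ℂ f₀ ^ (n - 1)) •
            ∑ i, algebraMap k ℂ (cf i) • ℓ i)) := by
      rw [← h2, smul_smul, inv_mul_cancel₀ hfn, one_smul]
    rw [h3, Finset.smul_sum, Finset.smul_sum, ← Finset.sum_sub_distrib, Finset.smul_sum]
    refine Finset.sum_congr rfl fun i _ ↦ ?_
    ext w
    simp only [FunLike.coe_smul, FunLike.coe_sub, Pi.smul_apply, Pi.sub_apply, smul_eq_mul,
      nsmul_eq_mul, map_mul, map_sub, map_inv₀, map_pow, map_natCast]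
    ring
  rw [← hsolve]
  exact hSd

/-! ### A polynomial over `k` evaluated at a `k`-rational point -/

omit [FiniteDimensional ℂ E] in
/-- `p^ℂ(ι(x₀)) = ι(p(x₀))` for `p ∈ k[Xᵢ]`, `x₀ ∈ k^ι` and `ι = algebraMap k ℂ`. [folklore] -/
private theorem eval_map_algebraMap_eq {ι : Type*} (p : MvPolynomial ι k) (x₀ : ι → k) :
    MvPolynomial.eval (fun l ↦ algebraMap k ℂ (x₀ l)) (MvPolynomial.map (algebraMap k ℂ) p) =
      algebraMap k ℂ (MvPolynomial.eval x₀ p) := by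
  rw [MvPolynomial.eval_map]
  exact (MvPolynomial.eval₂_comp_left (algebraMap k ℂ) (RingHom.id k) x₀ p).symm

/-! ### The core: a rational frame from a submersive presentation -/

/-- **Core of `exists_rational_cotangentFrame`, for a given submersive presentation.**  Let
`V ∋ pt(φ P)` be an affine open with `Γ(Y, V) = k[xᵢ : i ∈ ι]/(f_j : j ∈ σ)` a submersive
presentation (distinguished variables `x_{c(j)}`), `φ P` a `k`-rational point.  Then the
differentials at `P` of the FREE coordinates `x_a ∘ φ` (`a ∉ c(σ)`), read in the chart at `P`, are
linearly independent over `ℂ`, span `E^*`, and the differential at `P` of every `g ∈ Γ(Y, V)` is a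
`k`-linear combination of them. [cite: SerreGAGA1956, §2 n°6 Prop. 3 Cor. 2 (with §1 n°4)]
[cite: GortzWedhorn2020, §6.6 (6.6.3) and Thm. 6.28] -/
theorem exists_frame_of_submersivePresentation [IsManifold 𝓘(ℂ, E) ω M]
    (hφ : IsAnalytification E Y d φ) {V : Y.left.Opens} (hV : IsAffineOpen V)
    [Algebra k Γ(Y.left, V)]
    (halg : ∀ c, algebraMap k Γ(Y.left, V) c = SchemeOver.scalarRingHom Y V c)
    {ι σ : Type*} [Fintype ι] [Fintype σ] [DecidableEq ι] [DecidableEq σ]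
    (Pres : Algebra.SubmersivePresentation k Γ(Y.left, V) ι σ) (hdim : Pres.dimension = d)
    {P : M} (hPV : (φ P).pt ∈ V)
    (hP : ∀ (U : Y.left.Opens) (hU : (φ P).pt ∈ U) (s : Γ(Y.left, U)),
      ∃ c : k, (φ P).eval U hU s = algebraMap k ℂ c) :
    ∃ ℓ : {i : ι // i ∉ Set.range Pres.map} → E →L[ℂ] ℂ,
      (∀ a, HasFDerivAt (fun z ↦ evalOrZero V (Pres.val a.1) (φ ((chartAt E P).symm z))) (ℓ a)
        (chartAt E P P)) ∧
      LinearIndependent ℂ ℓ ∧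
      (∀ w : E →L[ℂ] ℂ, ∃ c : {i : ι // i ∉ Set.range Pres.map} → ℂ, w = ∑ a, c a • ℓ a) ∧
      ∀ g : Γ(Y.left, V), ∃ c : {i : ι // i ∉ Set.range Pres.map} → k,
        HasFDerivAt (fun z ↦ evalOrZero V g (φ ((chartAt E P).symm z)))
          (∑ a, algebraMap k ℂ (c a) • ℓ a) (chartAt E P P) := by
  classical
  haveI : IsManifold 𝓘(ℂ, E) 1 M := inferInstance
  haveI : CompleteSpace E := FiniteDimensional.complete ℂ E
  have hφinj : Function.Injective φ := hφ.isHomeomorph.injective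
  set χ : OpenPartialHomeomorph M E := chartAt E P with hχ
  set Q : ComplexPoints Y := φ P with hQdef
  have hQV : Q.pt ∈ V := hPV
  have hz₀ : χ P ∈ χ.target := χ.map_source (mem_chart_source E P)
  have hχP : χ.symm (χ P) = P := χ.left_inv (mem_chart_source E P)
  -- the relations over `ℂ` and the coordinate functions on `Y(ℂ)`
  set F : σ → MvPolynomial ι ℂ := fun j ↦ MvPolynomial.map (algebraMap k ℂ) (Pres.relation j)
    with hF
  set xf : ι → ComplexPoints Y → ℂ := fun i ↦ evalOrZero V (Pres.val i) with hxf
  /- (algebra) `x : V(ℂ) → ℂ^ι` is injective, lands in the zero set of the `F j`, and the Jacobian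
  of the `F j` in the distinguished variables does not vanish at `x(Q)`. -/
  have hrel : ∀ R : ComplexPoints Y, R.pt ∈ V → ∀ j, MvPolynomial.eval (fun i ↦ xf i R) (F j) = 0 :=
    fun R hR j ↦ eval_map_relation_eq_zero halg Pres.toPresentation hR j
  have hinjV : ∀ R R' : ComplexPoints Y, R.pt ∈ V → R'.pt ∈ V →
      (∀ i, xf i R = xf i R') → R = R' :=
    fun R R' hR hR' hx ↦ eq_of_evalOrZero_val_eq halg hV Pres.toGenerators hR hR' (funext hx)
  have hdet : (Matrix.of fun i j : σ ↦ MvPolynomial.eval (fun l ↦ xf l Q)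
      (MvPolynomial.pderiv (Pres.map i) (F j))).det ≠ 0 :=
    det_ne_zero_of_submersivePresentation halg Pres hQV
  /- (implicit functions) the free coordinates are injective on a neighbourhood `N₁` of `P`. -/
  obtain ⟨W, hWo, hcW, hWinj⟩ :=
    exists_isOpen_injOn_of_det_ne_zero Pres.map Pres.map_inj F (fun l ↦ xf l Q) hdet
  set N₁ : Set M := φ ⁻¹' {R | R.pt ∈ V} ∩ (fun m'' ↦ fun l ↦ xf l (φ m'')) ⁻¹' W with hN₁
  have hN₁o : IsOpen N₁ := by
    refine ContinuousOn.isOpen_inter_preimage ?_ (hφ.isOpen_preimage V) hWo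
    refine continuousOn_pi.2 fun l ↦ ?_
    exact (continuousOn_evalOrZero V (Pres.val l)).comp
      hφ.isHomeomorph.continuous.continuousOn fun m'' hm'' ↦ hm''
  have hmN₁ : P ∈ N₁ := ⟨hQV, hcW⟩
  have hinjN₁ : ∀ m₁ ∈ N₁, ∀ m₂ ∈ N₁,
      (∀ i : {i : ι // i ∉ Set.range Pres.map}, xf i.1 (φ m₁) = xf i.1 (φ m₂)) → m₁ = m₂ := by
    intro m₁ hm₁ m₂ hm₂ hfree
    apply hφinj
    refine hinjV _ _ hm₁.1 hm₂.1 fun i ↦ ?_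
    have key := hWinj _ hm₁.2 _ hm₂.2 (fun i hi ↦ hfree ⟨i, hi⟩)
      (fun j ↦ by rw [hrel _ hm₁.1, hrel _ hm₂.1])
    exact congrFun key i
  /- (Osgood) `T = x_free ∘ φ ∘ χ⁻¹` has bijective differential at `χ P`. -/
  set O : Set E := χ.target ∩ χ.symm ⁻¹' N₁ with hO
  have hOo : IsOpen O := χ.isOpen_inter_preimage_symm hN₁o
  set T : E → ({i : ι // i ∉ Set.range Pres.map} → ℂ) :=
    fun z i ↦ xf i.1 (φ (χ.symm z)) with hT
  have hz₀O : χ P ∈ O := ⟨hz₀, by show χ.symm (χ P) ∈ N₁; rw [hχP]; exact hmN₁⟩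
  have hTa : ∀ (a : {i : ι // i ∉ Set.range Pres.map}) (z : E), z ∈ O →
      DifferentiableAt ℂ (fun z ↦ T z a) z :=
    fun a z hz ↦ differentiableAt_evalOrZero_chart hφ P V (Pres.val a.1) hz.1 hz.2.1
  have hTd : DifferentiableOn ℂ T O := fun z hz ↦
    (differentiableAt_pi.2 fun a ↦ hTa a z hz).differentiableWithinAt
  have hTinj : Set.InjOn T O := by
    intro z hz z' hz' hzz'
    have : χ.symm z = χ.symm z' := hinjN₁ _ hz.2 _ hz'.2 fun i ↦ congrFun hzz' i
    rw [← χ.right_inv hz.1, ← χ.right_inv hz'.1, this]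
  have hcard : Fintype.card {i : ι // i ∉ Set.range Pres.map} = d := by
    rw [Fintype.card_subtype_compl]
    change Fintype.card ι - Fintype.card (Set.range Pres.map) = d
    rw [Set.card_range_of_injective Pres.map_inj, ← hdim, Algebra.Presentation.dimension,
      Nat.card_eq_fintype_card, Nat.card_eq_fintype_card]
  have hdimE : Module.finrank ℂ E =
      Module.finrank ℂ ({i : ι // i ∉ Set.range Pres.map} → ℂ) := by
    rw [hφ.finrank_eq, Module.finrank_fintype_fun_eq_card, hcard]
  have hbij := Literature.Analysis.Complex.SCV.bijective_fderiv_of_injOn hdimE hTd hOo hTinj hz₀O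
  set Λ : E ≃L[ℂ] ({i : ι // i ∉ Set.range Pres.map} → ℂ) :=
    ContinuousLinearEquiv.ofBijective (fderiv ℂ T (χ P)) (LinearMap.ker_eq_bot.2 hbij.1)
      (LinearMap.range_eq_top.2 hbij.2) with hΛ
  have hΛapply : ∀ v, Λ v = fderiv ℂ T (χ P) v := fun v ↦ rfl
  have hTdiff : HasFDerivAt T (fderiv ℂ T (χ P)) (χ P) :=
    ((hTd _ hz₀O).differentiableAt (hOo.mem_nhds hz₀O)).hasFDerivAt
  -- the differentials of ALL the coordinates at `χ P`
  set D : ι → E →L[ℂ] ℂ := fun l ↦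
    fderiv ℂ (fun z ↦ xf l (φ (χ.symm z))) (χ P) with hD
  have hDl : ∀ l, HasFDerivAt (fun z ↦ xf l (φ (χ.symm z))) (D l) (χ P) :=
    fun l ↦ hasFDerivAt_evalOrZero_chart hφ P V (Pres.val l) hPV
  -- the free ones are the components of the differential of `T`
  have hDfree : ∀ a : {i : ι // i ∉ Set.range Pres.map},
      D a.1 = (ContinuousLinearMap.proj (R := ℂ)
        (φ := fun _ : {i : ι // i ∉ Set.range Pres.map} ↦ ℂ) a).comp (fderiv ℂ T (χ P)) := by
    intro a
    have h1 : HasFDerivAt (fun z ↦ T z a) ((ContinuousLinearMap.proj (R := ℂ)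
        (φ := fun _ : {i : ι // i ∉ Set.range Pres.map} ↦ ℂ) a).comp (fderiv ℂ T (χ P))) (χ P) :=
      ((ContinuousLinearMap.proj (R := ℂ)
        (φ := fun _ : {i : ι // i ∉ Set.range Pres.map} ↦ ℂ) a).hasFDerivAt).comp (χ P) hTdiff
    exact (hDl a.1).unique h1
  set ℓ : {i : ι // i ∉ Set.range Pres.map} → E →L[ℂ] ℂ := fun a ↦ D a.1 with hℓ
  have hℓΛsymm : ∀ a b : {i : ι // i ∉ Set.range Pres.map},
      ℓ a (Λ.symm (Pi.single b 1)) = if a = b then 1 else 0 := by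
    intro a b
    have h1 : ℓ a (Λ.symm (Pi.single b 1)) = (fderiv ℂ T (χ P) (Λ.symm (Pi.single b 1))) a := by
      rw [hℓ]; simp only [hDfree a, ContinuousLinearMap.coe_comp, Function.comp_apply,
        ContinuousLinearMap.proj_apply]
    rw [h1, ← hΛapply, ContinuousLinearEquiv.apply_symm_apply, Pi.single_apply]
  -- linear independence
  have hli : LinearIndependent ℂ ℓ := by
    rw [Fintype.linearIndependent_iff]
    intro g hg b
    have h := congrArg (fun w : E →L[ℂ] ℂ ↦ w (Λ.symm (Pi.single b 1))) hg
    simp only [FunLike.coe_sum, Finset.sum_apply, FunLike.coe_smul, Pi.smul_apply, hℓΛsymm,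
      smul_eq_mul, mul_ite, mul_one, mul_zero, Finset.sum_ite_eq', Finset.mem_univ, if_true] at h
    simpa using h
  -- spanning: `w = ∑_a w(v_a) ℓ_a` with `v_a = Λ⁻¹ e_a` the dual vectors
  have hexp : ∀ v : E, v = ∑ a, ℓ a v • Λ.symm (Pi.single a 1) := by
    intro v
    apply Λ.injective
    rw [map_sum]
    simp only [_root_.map_smul, ContinuousLinearEquiv.apply_symm_apply]
    funext b
    rw [Finset.sum_apply, Finset.sum_eq_single b (fun a _ hab ↦ by
        rw [Pi.smul_apply, Pi.single_eq_of_ne (Ne.symm hab), smul_zero])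
      (fun hb ↦ absurd (Finset.mem_univ b) hb), Pi.smul_apply, Pi.single_eq_same, smul_eq_mul,
      mul_one, hΛapply, hℓ]
    simp only [hDfree b, ContinuousLinearMap.coe_comp, Function.comp_apply,
      ContinuousLinearMap.proj_apply]
  have hspan : ∀ w : E →L[ℂ] ℂ, ∃ c : {i : ι // i ∉ Set.range Pres.map} → ℂ,
      w = ∑ a, c a • ℓ a := by
    intro w
    refine ⟨fun a ↦ w (Λ.symm (Pi.single a 1)), ?_⟩
    ext v
    conv_lhs => rw [hexp v]
    simp only [map_sum, _root_.map_smul, smul_eq_mul, FunLike.coe_sum, Finset.sum_apply,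
      FunLike.coe_smul, Pi.smul_apply]
    exact Finset.sum_congr rfl fun a _ ↦ mul_comm _ _
  /- values at the `k`-rational point -/
  have hx₀ex : ∀ l, ∃ c : k, xf l Q = algebraMap k ℂ c := fun l ↦ by
    obtain ⟨c, hc⟩ := hP V hQV (Pres.val l)
    exact ⟨c, by simp only [hxf, evalOrZero_of_mem _ hQV, hc]⟩
  choose x₀ hx₀ using hx₀ex
  have hxQ : (fun l ↦ xf l Q) = fun l ↦ algebraMap k ℂ (x₀ l) := funext hx₀
  have hevalk : ∀ p : MvPolynomial ι k,
      MvPolynomial.eval (fun l ↦ xf l Q) (MvPolynomial.map (algebraMap k ℂ) p) =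
        algebraMap k ℂ (MvPolynomial.eval x₀ p) := fun p ↦ by
    rw [hxQ]; exact eval_map_algebraMap_eq p x₀
  /- the chain rule for polynomials in the coordinates -/
  have hφχP : φ (χ.symm (χ P)) = Q := by rw [hχP]
  have hpoly : ∀ p : MvPolynomial ι k,
      HasFDerivAt (fun z ↦ MvPolynomial.eval (fun l ↦ xf l (φ (χ.symm z)))
          (MvPolynomial.map (algebraMap k ℂ) p))
        (∑ l, algebraMap k ℂ (MvPolynomial.eval x₀ (MvPolynomial.pderiv l p)) • D l) (χ P) := by
    intro p
    have h := hasFDerivAt_mvPolynomial_eval_comp (MvPolynomial.map (algebraMap k ℂ) p)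
      (x := fun l z ↦ xf l (φ (χ.symm z))) hDl
    refine h.congr_fderiv (Finset.sum_congr rfl fun l _ ↦ ?_)
    rw [hφχP, MvPolynomial.pderiv_map, hevalk]
  /- distinguished coordinates: differentiate the relations and invert the Jacobian over `k` -/
  set J₀ : Matrix σ σ k := Matrix.of fun i j ↦
    MvPolynomial.eval x₀ (MvPolynomial.pderiv (Pres.map i) (Pres.relation j)) with hJ₀
  have hJ₀map : J₀.map (algebraMap k ℂ) = Matrix.of fun i j : σ ↦
      MvPolynomial.eval (fun l ↦ xf l Q) (MvPolynomial.pderiv (Pres.map i) (F j)) := by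
    ext i j
    simp only [Matrix.map_apply, Matrix.of_apply, hJ₀, hF, MvPolynomial.pderiv_map, hevalk]
  have hJ₀det : J₀.det ≠ 0 := by
    intro h0
    apply hdet
    rw [← hJ₀map, ← RingHom.mapMatrix_apply, ← RingHom.map_det, h0, map_zero]
  -- the relation `∑_l (∂_l f_j)(x₀) • D l = 0`
  have hrelD : ∀ j, ∑ l, algebraMap k ℂ
      (MvPolynomial.eval x₀ (MvPolynomial.pderiv l (Pres.relation j))) • D l = 0 := by
    intro j
    have h1 := hpoly (Pres.relation j)
    have h0 : (fun z ↦ MvPolynomial.eval (fun l ↦ xf l (φ (χ.symm z)))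
        (MvPolynomial.map (algebraMap k ℂ) (Pres.relation j))) =ᶠ[𝓝 (χ P)] fun _ ↦ 0 := by
      filter_upwards [chart_preimage_mem_nhds hφ P V hQV] with z hz
      exact hrel _ hz.2 j
    exact (h1.congr_of_eventuallyEq h0.symm).unique (hasFDerivAt_const (0 : ℂ) (χ P)) |>.trans
      rfl
  -- split the sum: free + distinguished
  have hsplit : ∀ c : ι → ℂ, ∑ l, c l • D l =
      ∑ a : {i : ι // i ∉ Set.range Pres.map}, c a.1 • ℓ a + ∑ j, c (Pres.map j) • D (Pres.map j) := by
    intro c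
    rw [← Finset.sum_add_sum_compl (Finset.univ.image Pres.map) (fun l ↦ c l • D l), add_comm,
      Finset.sum_image (fun j _ j' _ h ↦ Pres.map_inj h)]
    congr 1
    show ∑ i ∈ (Finset.univ.image Pres.map)ᶜ, c i • D i =
      ∑ a : {i : ι // i ∉ Set.range Pres.map}, c a.1 • D a.1
    refine Finset.sum_subtype _ (fun l ↦ ?_) (fun l ↦ c l • D l)
    simp only [Finset.mem_compl, Finset.mem_image, Finset.mem_univ, true_and, Set.mem_range]
  have hdist : ∀ j : σ, ∃ c : {i : ι // i ∉ Set.range Pres.map} → k,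
      D (Pres.map j) = ∑ a, algebraMap k ℂ (c a) • ℓ a := by
    refine exists_eq_sum_algebraMap_smul_of_matrix ℓ J₀.transpose
      (by rwa [Matrix.det_transpose]) (fun j ↦ D (Pres.map j))
      (fun j ↦ ∑ a : {i : ι // i ∉ Set.range Pres.map}, algebraMap k ℂ
        (-MvPolynomial.eval x₀ (MvPolynomial.pderiv a.1 (Pres.relation j))) • ℓ a)
      (fun j ↦ ?_) (fun j ↦ ⟨_, rfl⟩)
    have h := hrelD j
    rw [hsplit] at h
    simp only [Matrix.transpose_apply, hJ₀, Matrix.of_apply]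
    rw [eq_neg_of_add_eq_zero_right h]
    ext v
    simp only [FunLike.coe_neg, Pi.neg_apply, FunLike.coe_sum, Finset.sum_apply, FunLike.coe_smul,
      Pi.smul_apply, smul_eq_mul, map_neg, neg_mul, Finset.sum_neg_distrib]
  -- every coordinate differential is a `k`-combination of the frame
  have hDrat : ∀ l, ∃ c : {i : ι // i ∉ Set.range Pres.map} → k,
      D l = ∑ a, algebraMap k ℂ (c a) • ℓ a := by
    intro l
    by_cases hl : l ∈ Set.range Pres.map
    · obtain ⟨j, rfl⟩ := hl
      exact hdist j
    · exact exists_eq_sum_algebraMap_smul_self ℓ ⟨l, hl⟩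
  /- sections of `V`: polynomials in the coordinates -/
  have hVrat : ∀ g : Γ(Y.left, V), ∃ c : {i : ι // i ∉ Set.range Pres.map} → k,
      HasFDerivAt (fun z ↦ evalOrZero V g (φ (χ.symm z)))
        (∑ a, algebraMap k ℂ (c a) • ℓ a) (χ P) := by
    intro g
    set p : MvPolynomial ι k := Pres.σ g with hp
    obtain ⟨c, hc⟩ := exists_eq_sum_algebraMap_smul_sum ℓ Finset.univ
      (fun l ↦ MvPolynomial.eval x₀ (MvPolynomial.pderiv l p)) D (fun l _ ↦ hDrat l)
    refine ⟨c, ?_⟩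
    rw [← hc]
    refine (hpoly p).congr_of_eventuallyEq ?_
    filter_upwards [chart_preimage_mem_nhds hφ P V hQV] with z hz
    have hzV : (φ (χ.symm z)).pt ∈ V := hz.2
    rw [evalOrZero_of_mem g hzV, eval_eq_eval_map_σ halg Pres.toGenerators hzV g]
  exact ⟨ℓ, fun a ↦ hDl a.1, hli, hspan, hVrat⟩

/-! ### The theorem -/

/-- **A rational cotangent frame at a `k`-rational point of an analytification** (GAGA at one
point; Serre §2 n°6 Prop. 3 Cor. 2, Görtz–Wedhorn I (6.6.3) / Thm. 6.28, Shimura §2.6 Prop. 3).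
Let `φ : M → Y(ℂ)` be an analytification, with holomorphic atlas, of a `k`-scheme `Y` (`k ⊆ ℂ`)
smooth of relative dimension `d` and locally of finite type, and let `P ∈ M` lie over a
`k`-rational point: every regular function on an open `U ∋ pt(φ P)` takes at `φ P` a value in `k`.
Then there are `ℓ₁, …, ℓ_d ∈ E^*` such that: (1) the `ℓᵢ` are linearly independent over `ℂ`;
(2) they span `E^*`; (3) each `ℓᵢ` is the differential at `χ P` (`χ` the chart of `M` at `P`) of
`z ↦ s(φ(χ⁻¹ z))` for some regular function `s` over `k` near `pt(φ P)`; (4) for EVERY open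
`U ∋ pt(φ P)` and `s ∈ Γ(Y, U)` the differential at `χ P` of `z ↦ s(φ(χ⁻¹ z))` is `∑ᵢ cᵢ ℓᵢ` with
`cᵢ ∈ k`.  («The `k`-span of the algebraic differentials at `P` is a `k`-form of `T*_P M`.»)
[cite: SerreGAGA1956, §2 n°6 Prop. 3 Cor. 2 (with §1 n°4)]
[cite: GortzWedhorn2020, §6.6 (6.6.2)–(6.6.3) and Thm. 6.28] [cite: Shimura1998, §2.6 Prop. 3 (p. 20)] -/
theorem exists_rational_cotangentFrame [LocallyOfFiniteType Y.hom]
    [SmoothOfRelativeDimension d Y.hom] [IsManifold 𝓘(ℂ, E) ω M] (hφ : IsAnalytification E Y d φ)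
    {P : M} (hP : ∀ (U : Y.left.Opens) (hU : (φ P).pt ∈ U) (s : Γ(Y.left, U)),
      ∃ c : k, (φ P).eval U hU s = algebraMap k ℂ c) :
    ∃ ℓ : Fin d → E →L[ℂ] ℂ,
      LinearIndependent ℂ ℓ ∧
      ⊤ ≤ Submodule.span ℂ (Set.range ℓ) ∧
      (∀ i, ∃ (U : Y.left.Opens) (s : Γ(Y.left, U)), (φ P).pt ∈ U ∧
        HasFDerivAt (fun z ↦ evalOrZero U s (φ ((chartAt E P).symm z))) (ℓ i)
          (chartAt E P P)) ∧
      ∀ (U : Y.left.Opens) (s : Γ(Y.left, U)), (φ P).pt ∈ U → ∃ c : Fin d → k,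
        HasFDerivAt (fun z ↦ evalOrZero U s (φ ((chartAt E P).symm z)))
          (∑ i, algebraMap k ℂ (c i) • ℓ i) (chartAt E P P) := by
  classical
  /- Step 1: a submersive presentation `Γ(Y, V) = k[xᵢ]/(f_j)` of dimension `d` on an affine open
  `V ∋ pt(φ P)`. -/
  obtain ⟨V, hV, hPV, hstd⟩ :=
    exists_isStandardSmoothOfRelativeDimension_scalarRingHom d (φ P)
  letI alg : Algebra k Γ(Y.left, V) := (SchemeOver.scalarRingHom Y V).toAlgebra
  have halg : ∀ c, algebraMap k Γ(Y.left, V) c = SchemeOver.scalarRingHom Y V c := fun _ ↦ rfl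
  obtain ⟨ι, σ, _, _, Pres, hPdim⟩ := hstd.toAlgebra.out
  cases nonempty_fintype ι
  cases nonempty_fintype σ
  obtain ⟨ℓ', hℓ'D, hli', hspan', hVrat'⟩ :=
    exists_frame_of_submersivePresentation hφ hV halg Pres hPdim hPV hP
  -- reindex the free variables by `Fin d`
  have hcard : Fintype.card {i : ι // i ∉ Set.range Pres.map} = d := by
    rw [Fintype.card_subtype_compl]
    change Fintype.card ι - Fintype.card (Set.range Pres.map) = d
    rw [Set.card_range_of_injective Pres.map_inj, ← hPdim, Algebra.Presentation.dimension,
      Nat.card_eq_fintype_card, Nat.card_eq_fintype_card]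
  let e : Fin d ≃ {i : ι // i ∉ Set.range Pres.map} := (Fintype.equivFinOfCardEq hcard).symm
  refine ⟨fun i ↦ ℓ' (e i), hli'.comp e e.injective, ?_, fun i ↦
    ⟨V, Pres.val (e i).1, hPV, hℓ'D (e i)⟩, fun U s hU ↦ ?_⟩
  · rintro w -
    obtain ⟨c, rfl⟩ := hspan' w
    refine Submodule.sum_mem _ fun a _ ↦ Submodule.smul_mem _ _ (Submodule.subset_span ⟨e.symm a, ?_⟩)
    simp only [Equiv.apply_symm_apply]
  · obtain ⟨c, hc⟩ := exists_hasFDerivAt_eq_sum_of_affine hφ hV hPV hP ℓ' hVrat' U s hU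
    refine ⟨fun i ↦ c (e i), ?_⟩
    rwa [← e.sum_comp (fun a ↦ algebraMap k ℂ (c a) • ℓ' a)] at hc

end IsAnalytification

end Literature.NumberTheory.Transcendental

end
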